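import Mathlib
import HarnessLib
import HarnessLib.Audit
import Summits.ResolutionOfSingularities.ResolutionOfSingularities.Theses.WeightedInvariant
import Literature.AlgebraicGeometry.Resolution.CobordantChartCoefficients
import Literature.AlgebraicGeometry.Resolution.CobordantGame
import Summits.ResolutionOfSingularities.ResolutionOfSingularities.Theorems.WeightedInvariantGlobalizeLocalDropCanonize
import Summits.ResolutionOfSingularities.ResolutionOfSingularities.Theorems.WeightedInvariantGlobalizeLocalDropCylinder
import Summits.ResolutionOfSingularities.ResolutionOfSingularities.Theorems.WeightedInvariantGlobalizeLocalDropRegularGerms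
import Summits.ResolutionOfSingularities.ResolutionOfSingularities.Theorems.WeightedInvariantLocalWeightedDropGradingDescent
import Summits.ResolutionOfSingularities.ResolutionOfSingularities.Theorems.WeightedInvariantLocalWeightedDropUnitRoot
import Summits.ResolutionOfSingularities.ResolutionOfSingularities.Theorems.WeightedInvariantLocalWeightedDropSliceCyl
import Summits.ResolutionOfSingularities.ResolutionOfSingularities.Theorems.WeightedInvariantLocalWeightedDropTameSliceKappa

/-!
# Crux `LocalWeightedDrop` — line `vertex-descent-weight-residues` (lead's skeleton, reshaped)

Crux item stmt-ResolutionOfSingularities-8899, route ResolutionOfSingularities/WeightedInvariant.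

Composition idea (the planner's line, reconstructed from the ledger's stub registry — the planner's file is not
readable from the lead's jail): ONE ordinal rank `ρ` on formal germs in all embedding dimensions which is monotone
under formal coordinate changes, multiplication by units and passage to a cylinder, and which after SOME weighted
cobordant move drops at every off-vertex singular successor — measured on the `n`-variable flat SLICE `g|_{yᵢ=0}` at a
TAME coordinate (`cᵢ ≠ 0`, `p ∤ wᵢ`) and on the honest `(n+1)`-variable successor at WILD points (all `wᵢ` with
`cᵢ ≠ 0` divisible by `p`), where the successor carries the `μ_D`-grading descended from the vertex
(`stub_gradingDescent`).  The crux's `ι` is `ρ` itself: at a tame point the successor is a unit times a coordinate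
change of the cylinder over its slice (TAME SLICE = Luna's étale slice for the `G_m`-action on Włodarczyk's `B₊`;
here cut into `stub_unitRoot` + `stub_tameSliceKappa` + `stub_sliceCyl`), so the three monotonicities carry the
slice drop up to `g`.

Stubs (registered): `stub_gradingDescent` [LANDED p73016], `stub_unitRoot` [LANDED p73337], `stub_sliceCyl` [LANDED p73447],
`stub_tameSliceKappa` [LANDED p73411] — cited below from their Theorems files — and `stub_hornedRank` [XL, hardest — the
lead's, the only remaining `sorry`].  Everything else in this file is sorry-free, including the CONVERSE
`hornedRank_of_LocalWeightedDrop` (crux ⇒ stub, `ρ := CobordantGame.leastRank`): the reshaped hardest stub is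
EQUIVALENT to the crux, i.e. this line is a faithful equivariant reformulation of `LocalWeightedDrop`, not a reduction.
-/

set_option linter.dupNamespace false -- `Summit.ResolutionOfSingularities.ResolutionOfSingularities` is the mandated namespace of this single-conjunct summit (lakefile weak option)

namespace Summit.ResolutionOfSingularities.ResolutionOfSingularities.Theorems.LocalWeightedDropLine

open Literature.AlgebraicGeometry.Resolution

/-! ## Registered stubs -/

/-- GRADING DESCENT (vertex ⇒ every exceptional point).  In the factorisation `F(s^w(c+y)) = sᵃ·g` at an exceptional
point `c` (convention `cᵢ = 0` when `wᵢ = 0`), every monomial `s^r y^β` of `g` satisfies `w·β ≡ a + r (mod D)` for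
every `D` dividing all `wᵢ` with `cᵢ ≠ 0`: the torus grading of the vertex successor descends to a `ℤ/D`-grading. -/
theorem stub_gradingDescent : ∀ (k : Type) [Field k] (n : ℕ) (F : MvPowerSeries (Fin n) k) (w : Fin n → ℕ)
    (c : Fin n → k), (∀ i, w i = 0 → c i = 0) → ∀ (a : ℕ) (g : MvPowerSeries (Fin (n + 1)) k),
    MvPowerSeries.subst (CobordantChart.chart w c) F = MvPowerSeries.X 0 ^ a * g →
    ∀ D : ℕ, (∀ i, c i ≠ 0 → D ∣ w i) → ∀ e : Fin (n + 1) →₀ ℕ, MvPowerSeries.coeff e g ≠ 0 →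
    Finsupp.weight w (Finsupp.tail e) ≡ a + e 0 [MOD D] :=
  Summit.ResolutionOfSingularities.ResolutionOfSingularities.Theorems.stub_gradingDescent

/-- UNIT ROOT.  Over a field in which `m ≠ 0`, the 1-unit `1 + c⁻¹·X_j` has an `m`-th root `r ≡ 1 (mod X_j)` which is a
power series in the single variable `X_j`. -/
theorem stub_unitRoot : ∀ (k : Type) [Field k] (n : ℕ) (j : Fin (n + 1)) (m : ℕ), (m : k) ≠ 0 → ∀ (c : k), c ≠ 0 →
    ∃ r : MvPowerSeries (Fin (n + 1)) k, MvPowerSeries.constantCoeff r = 1 ∧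
      r ^ m = 1 + MvPowerSeries.C c⁻¹ * MvPowerSeries.X j ∧
      ∀ e : Fin (n + 1) →₀ ℕ, MvPowerSeries.coeff e r ≠ 0 → ∀ l, l ≠ j → e l = 0 :=
  Summit.ResolutionOfSingularities.ResolutionOfSingularities.Theorems.stub_unitRoot

/-- SLICE-THEN-CYLINDER = KILLING `yᵢ`.  Restricting `g(s,y)` to the slice `yᵢ = 0` (renumbered to `n` variables) and
re-embedding it as a cylinder along `yᵢ` is the substitution `yᵢ ↦ 0`. -/
theorem stub_sliceCyl : ∀ (k : Type) [Field k] (n : ℕ) (i : Fin n) (g : MvPowerSeries (Fin (n + 1)) k),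
    MvPowerSeries.subst (fun m : Fin n => (MvPowerSeries.X ((Fin.succ i).succAbove m) : MvPowerSeries (Fin (n + 1)) k))
      (MvPowerSeries.subst (fun j : Fin (n + 1) => if j = i.succ then (0 : MvPowerSeries (Fin n) k)
        else MvPowerSeries.X (Fin.predAbove i j)) g) =
    MvPowerSeries.subst (fun j : Fin (n + 1) => if j = i.succ then (0 : MvPowerSeries (Fin (n + 1)) k)
      else MvPowerSeries.X j) g :=
  Summit.ResolutionOfSingularities.ResolutionOfSingularities.Theorems.stub_sliceCyl

/-- TAME SLICE, transport form (Luna's étale slice on `B₊` at a point with `cᵢ ≠ 0`, given a `wᵢ`-th root `r` of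
`1 + yᵢ/cᵢ`): the successor `g` is a unit times a formal coordinate change of `g|_{yᵢ = 0}`.  (Torus reparametrisation
`s ↦ r⁻¹s`, `yⱼ ↦ r^{wⱼ}(cⱼ+yⱼ) − cⱼ` fixes the chart off `i` and kills `yᵢ` in the `i`-th chart entry; then invert it.) -/
theorem stub_tameSliceKappa : ∀ (k : Type) [Field k] (n : ℕ) (F : MvPowerSeries (Fin n) k) (w : Fin n → ℕ)
    (c : Fin n → k), (∀ i, w i = 0 → c i = 0) → ∀ (a : ℕ) (g : MvPowerSeries (Fin (n + 1)) k),
    MvPowerSeries.subst (CobordantChart.chart w c) F = MvPowerSeries.X 0 ^ a * g →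
    ∀ (i : Fin n), c i ≠ 0 → ∀ (r : MvPowerSeries (Fin (n + 1)) k), MvPowerSeries.constantCoeff r = 1 →
    r ^ (w i) = 1 + MvPowerSeries.C (c i)⁻¹ * MvPowerSeries.X i.succ →
    (∀ e : Fin (n + 1) →₀ ℕ, MvPowerSeries.coeff e r ≠ 0 → ∀ l, l ≠ i.succ → e l = 0) →
    ∃ (Φ : Fin (n + 1) → MvPowerSeries (Fin (n + 1)) k) (u : MvPowerSeries (Fin (n + 1)) k),
      (∀ j, MvPowerSeries.constantCoeff (Φ j) = 0) ∧
      IsUnit (Matrix.det (Matrix.of fun j l => MvPowerSeries.coeff (Finsupp.single l 1) (Φ j))) ∧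
      MvPowerSeries.constantCoeff u ≠ 0 ∧
      g = u * MvPowerSeries.subst Φ (MvPowerSeries.subst
        (fun j : Fin (n + 1) => if j = i.succ then (0 : MvPowerSeries (Fin (n + 1)) k) else MvPowerSeries.X j) g) :=
  Summit.ResolutionOfSingularities.ResolutionOfSingularities.Theorems.stub_tameSliceKappa

/-- HORNED RANK (hardest stub; the line's transfer `C⁺`).  One ordinal rank on formal germs in all embedding
dimensions, monotone under coordinate changes / units / cylinders, which after some weighted cobordant move drops at
every off-vertex singular successor `g` (which carries the descended `ℤ/D`-grading): EITHER on the `n`-variable flat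
slice `g|_{yᵢ=0}` at some tame coordinate (`cᵢ ≠ 0`, `p ∤ wᵢ`) OR on `g` itself (the only option at a wild point).
Lead's reshape (cycle 1): the second disjunct no longer demands that the point be wild — a strict weakening of the
planner's clause, still sufficient for the composition, and with it the stub is implied by the crux for the least game
rank up to the routine monotonicities (see the lead's assessment note). -/
theorem stub_hornedRank : ∀ (p : ℕ), p.Prime → ∀ (k : Type) [Field k] [CharP k p] [IsAlgClosed k],
    ∃ ρ : (n : ℕ) → MvPowerSeries (Fin n) k → Ordinal.{0},
    (∀ (n : ℕ) (f : MvPowerSeries (Fin n) k) (Φ : Fin n → MvPowerSeries (Fin n) k),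
      (∀ i, MvPowerSeries.constantCoeff (Φ i) = 0) →
      IsUnit (Matrix.det (Matrix.of fun i j => MvPowerSeries.coeff (Finsupp.single j 1) (Φ i))) →
      ρ n (MvPowerSeries.subst Φ f) ≤ ρ n f) ∧
    (∀ (n : ℕ) (f u : MvPowerSeries (Fin n) k), MvPowerSeries.constantCoeff u ≠ 0 → ρ n (u * f) ≤ ρ n f) ∧
    (∀ (n : ℕ) (j : Fin (n + 1)) (h : MvPowerSeries (Fin n) k),
      ρ (n + 1) (MvPowerSeries.subst (fun m : Fin n => (MvPowerSeries.X (j.succAbove m) : MvPowerSeries (Fin (n + 1)) k)) h)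
        ≤ ρ n h) ∧
    ∀ (n : ℕ) (f : MvPowerSeries (Fin n) k),
      (f ≠ 0 ∧ MvPowerSeries.constantCoeff f = 0 ∧ ∀ i, MvPowerSeries.coeff (Finsupp.single i 1) f = 0) →
      ∃ (θ : Fin n → MvPowerSeries (Fin n) k) (w : Fin n → ℕ),
        (∀ i, MvPowerSeries.constantCoeff (θ i) = 0) ∧
        IsUnit (Matrix.det (Matrix.of fun i j => MvPowerSeries.coeff (Finsupp.single j 1) (θ i))) ∧
        (∃ i, 0 < w i) ∧
        ∀ (c : Fin n → k), (∀ i, w i = 0 → c i = 0) → c ≠ 0 →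
        ∀ (a : ℕ) (g : MvPowerSeries (Fin (n + 1)) k),
          MvPowerSeries.subst (CobordantChart.chart w c) (MvPowerSeries.subst θ f) = MvPowerSeries.X 0 ^ a * g →
          ¬ (MvPowerSeries.X (0 : Fin (n + 1)) ∣ g) →
          (MvPowerSeries.constantCoeff g = 0 ∧ ∀ j, MvPowerSeries.coeff (Finsupp.single j 1) g = 0) →
          (∀ D : ℕ, (∀ i, c i ≠ 0 → D ∣ w i) → ∀ e : Fin (n + 1) →₀ ℕ, MvPowerSeries.coeff e g ≠ 0 →
            Finsupp.weight w (Finsupp.tail e) ≡ a + e 0 [MOD D]) →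
          ((∃ i : Fin n, c i ≠ 0 ∧ ¬ (p ∣ w i) ∧
              ρ n (MvPowerSeries.subst (fun j : Fin (n + 1) => if j = i.succ then (0 : MvPowerSeries (Fin n) k)
                else MvPowerSeries.X (Fin.predAbove i j)) g) < ρ n f) ∨
            ρ (n + 1) g < ρ n f) := by
  sorry

/-! ## Sorry-free glue -/

/-- INDUCTIVE NORMAL FORM of the crux (sorry-free; `Literature…CobordantGame`, p73982, as re-exported by seat 14763's
`Theorems.localWeightedDrop_iff_allWon`): `LocalWeightedDrop` holds iff,
over every algebraically closed field of prime characteristic, every singular germ lies in the inductive winning region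
`CobordantGame.Won` of the local weighted resolution game (some legal move all of whose singular `s`-saturated successors
are won).  This is the form in which partial results ("this germ / this class is won") can be landed, and the form the
lead recommends for the promoted hardest stub. -/
theorem LocalWeightedDrop_iff_allWon :
    Summit.ResolutionOfSingularities.ResolutionOfSingularities.Theses.WeightedInvariant.LocalWeightedDrop ↔
    ∀ (p : ℕ), p.Prime → ∀ (k : Type) [Field k] [CharP k p] [IsAlgClosed k],
      ∀ (n : ℕ) (f : MvPowerSeries (Fin n) k), CobordantGame.IsSingular k f → CobordantGame.Won k n f :=
  Summit.ResolutionOfSingularities.ResolutionOfSingularities.Theorems.localWeightedDrop_iff_allWon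

/-- The planner's TAME SLICE stub in its filed form, derived from `stub_unitRoot`, `stub_tameSliceKappa` and
`stub_sliceCyl`: at an exceptional point with `cᵢ ≠ 0` and `p ∤ wᵢ` the `s`-saturated successor `g` is a unit times a
formal coordinate change of the cylinder over its `n`-variable flat slice `g|_{yᵢ = 0}`. -/
theorem tameSlice : ∀ (p : ℕ), p.Prime → ∀ (k : Type) [Field k] [CharP k p] (n : ℕ) (F : MvPowerSeries (Fin n) k)
    (w : Fin n → ℕ) (c : Fin n → k), (∀ i, w i = 0 → c i = 0) → ∀ (a : ℕ) (g : MvPowerSeries (Fin (n + 1)) k),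
    MvPowerSeries.subst (CobordantChart.chart w c) F = MvPowerSeries.X 0 ^ a * g → ∀ i : Fin n, c i ≠ 0 → ¬ (p ∣ w i) →
    ∃ (Φ : Fin (n + 1) → MvPowerSeries (Fin (n + 1)) k) (u : MvPowerSeries (Fin (n + 1)) k),
      (∀ j, MvPowerSeries.constantCoeff (Φ j) = 0) ∧
      IsUnit (Matrix.det (Matrix.of fun j l => MvPowerSeries.coeff (Finsupp.single l 1) (Φ j))) ∧
      MvPowerSeries.constantCoeff u ≠ 0 ∧
      g = u * MvPowerSeries.subst Φ (MvPowerSeries.subst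
        (fun m : Fin n => (MvPowerSeries.X ((Fin.succ i).succAbove m) : MvPowerSeries (Fin (n + 1)) k))
        (MvPowerSeries.subst (fun j : Fin (n + 1) => if j = i.succ then (0 : MvPowerSeries (Fin n) k)
          else MvPowerSeries.X (Fin.predAbove i j)) g)) := by
  intro p hp k _ _ n F w c hc a g hfac i hci hpw
  have hm : ((w i : ℕ) : k) ≠ 0 := by
    intro h
    exact hpw ((CharP.cast_eq_zero_iff k p (w i)).mp h)
  obtain ⟨r, hr1, hrw, hrsupp⟩ := stub_unitRoot k n i.succ (w i) hm (c i) hci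
  obtain ⟨Φ, u, hΦ0, hΦdet, hu, hg⟩ := stub_tameSliceKappa k n F w c hc a g hfac i hci r hr1 hrw hrsupp
  refine ⟨Φ, u, hΦ0, hΦdet, hu, ?_⟩
  rw [stub_sliceCyl k n i g]
  exact hg

/-- THE COMPOSITION: the line closes the crux `LocalWeightedDrop` BY NAME, modulo the single remaining registered
stub `stub_hornedRank` (the four other stubs are landed theorems).  `ι := ρ` of `stub_hornedRank`; the crux's literal chart is `CobordantChart.chart w c'` with `c'` the crux-convention point
(`cruxChart_eq_chart`); the grading hypothesis is `stub_gradingDescent`; the tame branch is closed by `tameSlice` and the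
three monotonicities of `ρ`, the wild branch is the stub's drop itself. -/
theorem LocalWeightedDrop_of :
    Summit.ResolutionOfSingularities.ResolutionOfSingularities.Theses.WeightedInvariant.LocalWeightedDrop := by
  intro p hp k _ _ _
  obtain ⟨ρ, hAut, hUnit, hCyl, hMove⟩ := stub_hornedRank p hp k
  refine ⟨ρ, ?_⟩
  intro n f hf
  obtain ⟨θ, w, hθ0, hθdet, hwpos, hdrop⟩ := hMove n f hf
  refine ⟨θ, w, hθ0, hθdet, hwpos, ?_⟩
  intro c hc a g hfac hndvd hsing
  -- the crux-convention point
  set c' : Fin n → k := fun i => if 0 < w i then c i else 0 with hc'def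
  have hconv : ∀ i, w i = 0 → c' i = 0 := by
    intro i hi
    simp [hc'def, hi]
  have hne : c' ≠ 0 := by
    obtain ⟨i, hwi, hci⟩ := hc
    intro h
    have := congrFun h i
    simp [hc'def, hwi] at this
    exact hci this
  have hchart := CobordantChart.cruxChart_eq_chart (k := k) w c
  rw [hchart] at hfac
  have hgrad := stub_gradingDescent k n (MvPowerSeries.subst θ f) w c' hconv a g hfac
  rcases hdrop c' hconv hne a g hfac hndvd hsing hgrad with ⟨i, hci, hpw, hlt⟩ | hlt
  · -- tame point: slice drop, carried up to `g` by the tame slice and the monotonicities of `ρ`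
    obtain ⟨Φ, u, hΦ0, hΦdet, hu, hg⟩ :=
      tameSlice p hp k n (MvPowerSeries.subst θ f) w c' hconv a g hfac i hci hpw
    calc ρ (n + 1) g
        = ρ (n + 1) (u * MvPowerSeries.subst Φ (MvPowerSeries.subst
            (fun m : Fin n => (MvPowerSeries.X ((Fin.succ i).succAbove m) : MvPowerSeries (Fin (n + 1)) k))
            (MvPowerSeries.subst (fun j : Fin (n + 1) => if j = i.succ then (0 : MvPowerSeries (Fin n) k)
              else MvPowerSeries.X (Fin.predAbove i j)) g))) := by rw [← hg]
      _ ≤ ρ (n + 1) (MvPowerSeries.subst Φ (MvPowerSeries.subst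
            (fun m : Fin n => (MvPowerSeries.X ((Fin.succ i).succAbove m) : MvPowerSeries (Fin (n + 1)) k))
            (MvPowerSeries.subst (fun j : Fin (n + 1) => if j = i.succ then (0 : MvPowerSeries (Fin n) k)
              else MvPowerSeries.X (Fin.predAbove i j)) g))) := hUnit _ _ _ hu
      _ ≤ ρ (n + 1) (MvPowerSeries.subst
            (fun m : Fin n => (MvPowerSeries.X ((Fin.succ i).succAbove m) : MvPowerSeries (Fin (n + 1)) k))
            (MvPowerSeries.subst (fun j : Fin (n + 1) => if j = i.succ then (0 : MvPowerSeries (Fin n) k)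
              else MvPowerSeries.X (Fin.predAbove i j)) g)) := hAut _ _ Φ hΦ0 hΦdet
      _ ≤ ρ n (MvPowerSeries.subst (fun j : Fin (n + 1) => if j = i.succ then (0 : MvPowerSeries (Fin n) k)
              else MvPowerSeries.X (Fin.predAbove i j)) g) := hCyl n i.succ _
      _ < ρ n f := hlt
  · -- wild point: the stub's drop on the honest successor
    exact hlt

/-- THE CONVERSE (sorry-free): the crux implies the hardest stub's statement, with `ρ :=` the least game value
`CobordantGame.leastRank`.  Its monotonicity under coordinate changes and units holds as unconditional EQUALITIES and
under cylinders at won germs (seat 14763's `Theorems.leastRank_subst`, `leastRank_unit_mul`, `leastRank_cyl_le`,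
`leastRank_cyl_fin_zero`, `won_of_allSingularWon`, built on `Literature…CobordantGame`), and the move clause is met
through its second disjunct by the least value's own drop.  Together with `LocalWeightedDrop_of` (whose proof uses
nothing about `stub_hornedRank` but its statement): the (reshaped) hardest stub is EQUIVALENT to the crux. -/
theorem hornedRank_of_LocalWeightedDrop
    (h : Summit.ResolutionOfSingularities.ResolutionOfSingularities.Theses.WeightedInvariant.LocalWeightedDrop) :
    ∀ (p : ℕ), p.Prime → ∀ (k : Type) [Field k] [CharP k p] [IsAlgClosed k],
    ∃ ρ : (n : ℕ) → MvPowerSeries (Fin n) k → Ordinal.{0},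
    (∀ (n : ℕ) (f : MvPowerSeries (Fin n) k) (Φ : Fin n → MvPowerSeries (Fin n) k),
      (∀ i, MvPowerSeries.constantCoeff (Φ i) = 0) →
      IsUnit (Matrix.det (Matrix.of fun i j => MvPowerSeries.coeff (Finsupp.single j 1) (Φ i))) →
      ρ n (MvPowerSeries.subst Φ f) ≤ ρ n f) ∧
    (∀ (n : ℕ) (f u : MvPowerSeries (Fin n) k), MvPowerSeries.constantCoeff u ≠ 0 → ρ n (u * f) ≤ ρ n f) ∧
    (∀ (n : ℕ) (j : Fin (n + 1)) (h : MvPowerSeries (Fin n) k),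
      ρ (n + 1) (MvPowerSeries.subst (fun m : Fin n => (MvPowerSeries.X (j.succAbove m) : MvPowerSeries (Fin (n + 1)) k)) h)
        ≤ ρ n h) ∧
    ∀ (n : ℕ) (f : MvPowerSeries (Fin n) k),
      (f ≠ 0 ∧ MvPowerSeries.constantCoeff f = 0 ∧ ∀ i, MvPowerSeries.coeff (Finsupp.single i 1) f = 0) →
      ∃ (θ : Fin n → MvPowerSeries (Fin n) k) (w : Fin n → ℕ),
        (∀ i, MvPowerSeries.constantCoeff (θ i) = 0) ∧
        IsUnit (Matrix.det (Matrix.of fun i j => MvPowerSeries.coeff (Finsupp.single j 1) (θ i))) ∧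
        (∃ i, 0 < w i) ∧
        ∀ (c : Fin n → k), (∀ i, w i = 0 → c i = 0) → c ≠ 0 →
        ∀ (a : ℕ) (g : MvPowerSeries (Fin (n + 1)) k),
          MvPowerSeries.subst (CobordantChart.chart w c) (MvPowerSeries.subst θ f) = MvPowerSeries.X 0 ^ a * g →
          ¬ (MvPowerSeries.X (0 : Fin (n + 1)) ∣ g) →
          (MvPowerSeries.constantCoeff g = 0 ∧ ∀ j, MvPowerSeries.coeff (Finsupp.single j 1) g = 0) →
          (∀ D : ℕ, (∀ i, c i ≠ 0 → D ∣ w i) → ∀ e : Fin (n + 1) →₀ ℕ, MvPowerSeries.coeff e g ≠ 0 →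
            Finsupp.weight w (Finsupp.tail e) ≡ a + e 0 [MOD D]) →
          ((∃ i : Fin n, c i ≠ 0 ∧ ¬ (p ∣ w i) ∧
              ρ n (MvPowerSeries.subst (fun j : Fin (n + 1) => if j = i.succ then (0 : MvPowerSeries (Fin n) k)
                else MvPowerSeries.X (Fin.predAbove i j)) g) < ρ n f) ∨
            ρ (n + 1) g < ρ n f) := by
  classical
  intro p hp k _ _ _
  have hall : ∀ (n : ℕ) (f : MvPowerSeries (Fin n) k), CobordantGame.IsSingular k f → CobordantGame.Won k n f :=
    (LocalWeightedDrop_iff_allWon.mp h) p hp k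
  refine ⟨CobordantGame.leastRank, ?_, ?_, ?_, ?_⟩
  · -- (H1) coordinate changes: an equality
    intro n f Φ hΦ0 hdet
    exact (Summit.ResolutionOfSingularities.ResolutionOfSingularities.Theorems.leastRank_subst hΦ0 hdet f).le
  · -- (H2) units: an equality
    intro n f u hu
    exact (Summit.ResolutionOfSingularities.ResolutionOfSingularities.Theorems.leastRank_unit_mul hu f).le
  · -- (H3) cylinders
    intro n j hh
    rcases Nat.eq_zero_or_pos n with rfl | hn
    · rw [Summit.ResolutionOfSingularities.ResolutionOfSingularities.Theorems.leastRank_cyl_fin_zero]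
      exact bot_le
    · exact Summit.ResolutionOfSingularities.ResolutionOfSingularities.Theorems.leastRank_cyl_le j
        (Summit.ResolutionOfSingularities.ResolutionOfSingularities.Theorems.won_of_allSingularWon hall hn hh)
  · -- (H4') the move clause, through its second disjunct
    intro n f hf
    have hW := CobordantGame.wonBy_leastRank (hall n f hf)
    rw [CobordantGame.wonBy_iff] at hW
    obtain ⟨θ, w, ⟨hθ0, hdet, hwpos⟩, hs⟩ := hW
    refine ⟨θ, w, hθ0, hdet, hwpos, ?_⟩
    intro c hconv hcne a g hfac hndvd hsing _hgrad
    right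
    have hsucc : CobordantGame.IsSuccessor k f θ w g := by
      refine ⟨c, a, ?_, ?_, hndvd, hsing⟩
      · have : ∃ i, c i ≠ 0 := by
          by_contra hh
          push Not at hh
          exact hcne (funext hh)
        obtain ⟨i, hi⟩ := this
        exact ⟨i, Nat.pos_of_ne_zero (fun h0 => hi (hconv i h0)), hi⟩
      · have hc' : (fun i => if 0 < w i then c i else 0) = c := by
          funext i
          by_cases hwi : 0 < w i
          · rw [if_pos hwi]
          · rw [if_neg hwi, hconv i (Nat.eq_zero_of_not_pos hwi)]
        have hchart : CobordantGame.cruxChart k w c = CobordantChart.chart w c := by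
          have := CobordantChart.cruxChart_eq_chart (k := k) w c
          rw [hc'] at this
          exact this
        rw [hchart]
        exact hfac
    obtain ⟨β, hβ, hWg⟩ := hs g hsucc
    exact lt_of_le_of_lt (CobordantGame.leastRank_le hWg) hβ

end Summit.ResolutionOfSingularities.ResolutionOfSingularities.Theorems.LocalWeightedDropLine

-- buildfix 2026-08-19: `#h21_check_skeleton` lives in HarnessLib.Audit.Check (gate scratch only since the
-- 2026-08-16 Audit split) and does not parse in a tree build; kept as a comment — `ledger skeleton check` re-injects it.
-- #h21_check_skeleton "stmt-ResolutionOfSingularities-8899" Summit.ResolutionOfSingularities.ResolutionOfSingularities.Theses.WeightedInvariant.LocalWeightedDrop stub_gradingDescent stub_unitRoot stub_sliceCyl stub_tameSliceKappa stub_hornedRank
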